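import Summits.AtomisticToContinuum.HydrodynamicLimit.Theorems.AntiMazurCoboundariesKineticFluxLdDecaySelfTiltObjects
import Summits.AtomisticToContinuum.HydrodynamicLimit.Theorems.AntiMazurCoboundariesKineticWindowGronwallWindowSubadditivity
import Mathlib.Algebra.Order.Chebyshev
import HarnessLib

/-!
# Window monotonicity of the quadratic functional (stub `stub_squareWindowMonotone`)

Crux `Summit.AtomisticToContinuum.HydrodynamicLimit.Theses.AntiMazurCoboundaries.KineticFluxLdDecay`
(stmt-AtomisticToContinuum-10967), line `self-tilted-edge-covariance`, registered stub
`stub_squareWindowMonotone : SquareWindowMonotone` (objects module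
`…Theorems.AntiMazurCoboundariesKineticFluxLdDecaySelfTiltObjects`).

For a hard-sphere flow `Φ` on `𝕋³`, a `Φ`-invariant probability law `μ` carried by the good set, a bounded
measurable observable `F`, a window `w` and an integer `m ≥ 1`, with `J_u(z) = ∫₀ᵘ F(Φ_r z) dr`:
`E_μ ((mw)⁻¹ J_{mw})² ≤ E_μ (w⁻¹ J_w)²` (in the crux's `∫⁻ … ofReal` currency). This is the `L²` twin of the
exponential window subadditivity
`KineticWindowGronwallWindowSubadditivity.lintegral_exp_window_mul_le_of_aemeasurable`, with the square in
place of `exp` and Cauchy–Schwarz in place of Hölder: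

* on good orbits `(mw)⁻¹ J_{mw} = m⁻¹ Σ_{k<m} Y ∘ (Φ_w)^[k]`, `Y = w⁻¹ J_w`
  (`KineticWindowGronwallWindowSubadditivity.window_eq_cesaro`);
* pointwise `(m⁻¹ Σ_{k<m} a_k)² ≤ m⁻¹ Σ_{k<m} a_k²` (`sq_sum_le_card_mul_sum_sq`);
* each `∫⁻ (Y ∘ (Φ_w)^[k])² dμ = ∫⁻ Y² dμ` by invariance of `μ` under the iterates of `Φ_w`
  (`MeasurePreserving.lintegral_comp` on a measurable modification of the `μ`-a.e. measurable `Y`).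
-/

noncomputable section

open MeasureTheory Set Filter Function
open scoped ENNReal BigOperators

namespace Summit.AtomisticToContinuum.HydrodynamicLimit.Theorems.SelfTilt

open Literature.Analysis.FluidPDE (HardSphereFlow Config)
open Summit.AtomisticToContinuum.HydrodynamicLimit.Theorems.KineticWindowGronwallWindowSubadditivity
  (window_eq_cesaro)

/-- Pointwise Cauchy–Schwarz for a Cesàro mean: `(m⁻¹ Σ_{k<m} a_k)² ≤ m⁻¹ Σ_{k<m} a_k²`. -/
private theorem sq_cesaro_le (m : ℕ) (a : ℕ → ℝ) :
    ((m : ℝ)⁻¹ * ∑ k ∈ Finset.range m, a k) ^ 2 ≤ (m : ℝ)⁻¹ * ∑ k ∈ Finset.range m, a k ^ 2 := by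
  rcases Nat.eq_zero_or_pos m with rfl | hm
  · simp
  have hm' : (0 : ℝ) < m := Nat.cast_pos.mpr hm
  have h := sq_sum_le_card_mul_sum_sq (s := Finset.range m) (f := a)
  rw [Finset.card_range] at h
  rw [mul_pow, sq (m : ℝ)⁻¹, mul_assoc]
  refine mul_le_mul_of_nonneg_left ?_ (inv_nonneg.mpr hm'.le)
  rw [inv_mul_le_iff₀ hm']
  exact h

/-- Cesàro second moments along a measure-preserving map, measurable functional:
`∫⁻ (m⁻¹ Σ_{k<m} Y ∘ T^[k])² dP ≤ ∫⁻ Y² dP` for `T` preserving `P`, `Y` measurable, `0 < m`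
(pointwise Cauchy–Schwarz, then invariance term by term). -/
private theorem lintegral_sq_cesaro_le {α : Type*} [MeasurableSpace α] (P : Measure α) (T : α → α)
    (hT : MeasurePreserving T P P) (Y : α → ℝ) (hY : Measurable Y) (m : ℕ) (hm : 0 < m) :
    ∫⁻ z, ENNReal.ofReal (((m : ℝ)⁻¹ * ∑ k ∈ Finset.range m, Y (T^[k] z)) ^ 2) ∂P ≤
      ∫⁻ z, ENNReal.ofReal (Y z ^ 2) ∂P := by
  have hc : 0 ≤ (m : ℝ)⁻¹ := inv_nonneg.mpr (Nat.cast_nonneg m)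
  have hmeas : ∀ k : ℕ, Measurable fun z => ENNReal.ofReal (Y (T^[k] z) ^ 2) := fun k =>
    ((hY.comp (hT.measurable.iterate k)).pow_const 2).ennreal_ofReal
  have hinv : ∀ k : ℕ, ∫⁻ z, ENNReal.ofReal (Y (T^[k] z) ^ 2) ∂P = ∫⁻ z, ENNReal.ofReal (Y z ^ 2) ∂P :=
    fun k => (hT.iterate k).lintegral_comp (f := fun z => ENNReal.ofReal (Y z ^ 2))
      (hY.pow_const 2).ennreal_ofReal
  calc ∫⁻ z, ENNReal.ofReal (((m : ℝ)⁻¹ * ∑ k ∈ Finset.range m, Y (T^[k] z)) ^ 2) ∂P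
      ≤ ∫⁻ z, ENNReal.ofReal ((m : ℝ)⁻¹ * ∑ k ∈ Finset.range m, Y (T^[k] z) ^ 2) ∂P :=
        lintegral_mono fun z => ENNReal.ofReal_le_ofReal (sq_cesaro_le m fun k => Y (T^[k] z))
    _ = ∫⁻ z, ENNReal.ofReal ((m : ℝ)⁻¹) * ∑ k ∈ Finset.range m, ENNReal.ofReal (Y (T^[k] z) ^ 2) ∂P := by
        refine lintegral_congr fun z => ?_
        rw [ENNReal.ofReal_mul hc, ENNReal.ofReal_sum_of_nonneg fun k _ => sq_nonneg _]
    _ = ENNReal.ofReal ((m : ℝ)⁻¹) * ∑ k ∈ Finset.range m, ∫⁻ z, ENNReal.ofReal (Y (T^[k] z) ^ 2) ∂P := by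
        rw [lintegral_const_mul _ (Finset.measurable_fun_sum _ fun k _ => hmeas k),
          lintegral_finsetSum _ fun k _ => hmeas k]
    _ = ENNReal.ofReal ((m : ℝ)⁻¹) * ∑ _k ∈ Finset.range m, ∫⁻ z, ENNReal.ofReal (Y z ^ 2) ∂P := by
        rw [Finset.sum_congr rfl fun k _ => hinv k]
    _ = ∫⁻ z, ENNReal.ofReal (Y z ^ 2) ∂P := by
        rw [Finset.sum_const, Finset.card_range, nsmul_eq_mul, ← mul_assoc,
          ENNReal.ofReal_inv_of_pos (Nat.cast_pos.mpr hm), ENNReal.ofReal_natCast,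
          ENNReal.inv_mul_cancel (Nat.cast_ne_zero.mpr hm.ne') (ENNReal.natCast_ne_top m), one_mul]

/-- Cesàro second moments along a measure-preserving map, `P`-a.e. measurable functional:
`∫⁻ (m⁻¹ Σ_{k<m} Y ∘ T^[k])² dP ≤ ∫⁻ Y² dP` (replace `Y` by a measurable modification, a.e. along every
iterate since `T^[k]` preserves `P`). -/
theorem lintegral_sq_cesaro_le_of_aemeasurable {α : Type*} [MeasurableSpace α] (P : Measure α)
    (T : α → α) (hT : MeasurePreserving T P P) (Y : α → ℝ) (hY : AEMeasurable Y P) (m : ℕ)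
    (hm : 0 < m) :
    ∫⁻ z, ENNReal.ofReal (((m : ℝ)⁻¹ * ∑ k ∈ Finset.range m, Y (T^[k] z)) ^ 2) ∂P ≤
      ∫⁻ z, ENNReal.ofReal (Y z ^ 2) ∂P := by
  have hk : ∀ k : ℕ, Y ∘ T^[k] =ᵐ[P] hY.mk Y ∘ T^[k] := fun k =>
    (hT.iterate k).quasiMeasurePreserving.ae_eq hY.ae_eq_mk
  have hall : ∀ᵐ z ∂P, ∀ k : ℕ, Y (T^[k] z) = hY.mk Y (T^[k] z) := ae_all_iff.mpr hk
  calc ∫⁻ z, ENNReal.ofReal (((m : ℝ)⁻¹ * ∑ k ∈ Finset.range m, Y (T^[k] z)) ^ 2) ∂P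
      = ∫⁻ z, ENNReal.ofReal (((m : ℝ)⁻¹ * ∑ k ∈ Finset.range m, hY.mk Y (T^[k] z)) ^ 2) ∂P := by
        refine lintegral_congr_ae ?_
        filter_upwards [hall] with z hz
        rw [Finset.sum_congr rfl fun k _ => hz k]
    _ ≤ ∫⁻ z, ENNReal.ofReal (hY.mk Y z ^ 2) ∂P :=
        lintegral_sq_cesaro_le P T hT (hY.mk Y) hY.measurable_mk m hm
    _ = ∫⁻ z, ENNReal.ofReal (Y z ^ 2) ∂P := by
        refine lintegral_congr_ae ?_
        filter_upwards [hY.ae_eq_mk] with z hz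
        rw [← hz]

/-- **Registered stub `stub_squareWindowMonotone`** — window monotonicity of the quadratic (L²-Drude)
functional: `E_μ ((mw)⁻¹ J_{mw})² ≤ E_μ (w⁻¹ J_w)²` for every hard-sphere flow `Φ` on `𝕋³`, every
`Φ`-invariant probability law `μ` carried by the good set, every bounded measurable `F`, `w > 0`, `m ≥ 1`. -/
theorem stub_squareWindowMonotone : SquareWindowMonotone := by
  intro ε n Φ μ _ hinv hgood F hFm hFb w m _hw hm
  obtain ⟨C, hC⟩ := hFb
  set Y : TPhase n → ℝ := fun z => w⁻¹ * pathInt Φ F w z with hYdef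
  have hYm : AEMeasurable Y μ := (aemeasurable_pathInt Φ hgood hFm w).const_mul _
  have hae : ∀ᵐ z ∂μ, z ∈ Φ.good := mem_ae_iff.mpr hgood
  calc ∫⁻ z, ENNReal.ofReal ((((m : ℝ) * w)⁻¹ * pathInt Φ F ((m : ℝ) * w) z) ^ 2) ∂μ
      = ∫⁻ z, ENNReal.ofReal (((m : ℝ)⁻¹ * ∑ k ∈ Finset.range m, Y ((Φ.flow w)^[k] z)) ^ 2) ∂μ := by
        refine lintegral_congr_ae (hae.mono fun z hz => ?_)
        simp only [hYdef, pathInt]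
        rw [window_eq_cesaro Φ F hz (fun a b => Φ.intervalIntegrable_comp_flow_of_bounded hz hFm hC a b) w m]
    _ ≤ ∫⁻ z, ENNReal.ofReal (Y z ^ 2) ∂μ :=
        lintegral_sq_cesaro_le_of_aemeasurable μ (Φ.flow w) (hinv w) Y hYm m hm
    _ = ∫⁻ z, ENNReal.ofReal ((w⁻¹ * pathInt Φ F w z) ^ 2) ∂μ := rfl

end Summit.AtomisticToContinuum.HydrodynamicLimit.Theorems.SelfTilt

end
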